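import Summits.CriticalPhenomena.PercolationContinuityZ3.Theorems.PercNearOneGluingNoHeavyLowerTailSahiThreeCopyNested
import Summits.CriticalPhenomena.PercolationContinuityZ3.Theorems.PercNearOneGluingNoHeavyLowerTailSahiThreeCopyBernstein

/-!
# `NoHeavyLowerTail` (crux stmt-CriticalPhenomena-4575), Sahi programme: **3C-SAHI FOR THE MEDIAN GADGET** `(x ∨ UV, U ∨ xV, V ∨ xU)` and its dual
# `(x(U∨V), U(x∨V), V(x∨U))` — arbitrary up-sets `U, V` of `{0,1}^d` and a fresh coordinate `x` — the two configurations of `{0,1}³` not reached by the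
# read-once closure (memo FROM-prim-sahi-p1-gen54-READONCE-CLOSURE, coverage.py: 12/8000 ordered triples)

Support file (Sahi cell, seat `prim-sahi-p1`, generation 54; `--supports stmt-CriticalPhenomena-4575`).  Pure proofs plus definitions (`gadA/B/C`, `dgadA/B/C`);
no `sorry`, standard axioms.

THE PROOF.  Along the fresh coordinate the sections are words in the two inner indicators `u = 1_U`, `v = 1_V`: `(uv, 1)`, `(u, w)`, `(v, w)` with `w = 1_{U∪V}
= u + v − uv` (gadget); `(0, w)`, `(uv, u)`, `(uv, v)` (dual).  By the slice recursion `N3_cons` each coefficient `c_{(k,b)}` is a linear form in the twenty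
three-copy counts `N_b(m₁;m₂;m₃)`, `m_i ∈ {1,u,v,uv}`; an exact LP (code gadget.py) finds it as a nonnegative INTEGER combination of Bonferroni counts
`N_b(P;Q;R) ≥ 0` (`P, Q, R` products of `u, v, 1−u, 1−v`) and — for the dual — three-copy Harris gaps `N_b(uv;1;R) − N_b(u;v;R) ≥ 0`; e.g. at `k = 0` the
gadget coefficient is `c_b(uv,u,v) = N_b(1;uv;u(1−v)) + N_b(1;uv;1−u) + N_b(1−v;uv;1−u)`.  `linarith` re-finds the combinations from the listed facts.
With this file every ordered triple of up-sets of `{0,1}³` is covered by a Lean theorem (`…ReadOnce` + this). [this work]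
-/

namespace Summit.CriticalPhenomena.PercolationContinuityZ3.Theorems.SahiThreeCopy

open Finset Function Literature.Combinatorics.Sahi2008
open scoped BigOperators

noncomputable section

variable {d : ℕ}

/-! ### §1 Two inner up-sets: indicator algebra -/

section TwoSets

variable (U V : Finset (Pt d))

/-- `1_{U∪V} = 1_U + 1_V − 1_U·1_V`. [this work] -/
theorem setInd_union_eq : setInd (U ∪ V) = setInd U + setInd V - setInd U * setInd V := by
  funext x
  simp only [setInd, Pi.add_apply, Pi.sub_apply, Pi.mul_apply, mem_union]
  by_cases hU : x ∈ U <;> by_cases hV : x ∈ V <;> simp [hU, hV]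

/-- `1_U · 1_U = 1_U`. [this work] -/
theorem setInd_mul_self' : setInd U * setInd U = setInd U := by rw [setInd_mul, inter_self]

/-- `(1_U 1_V) 1_U = 1_U 1_V`. [this work] -/
theorem uv_mul_u : setInd U * setInd V * setInd U = setInd U * setInd V := by
  rw [setInd_mul, setInd_mul]; congr 1; ext x; simp only [mem_inter]; tauto

/-- `(1_U 1_V) 1_V = 1_U 1_V`. [this work] -/
theorem uv_mul_v : setInd U * setInd V * setInd V = setInd U * setInd V := by
  rw [setInd_mul, setInd_mul]; congr 1; ext x; simp only [mem_inter]; tauto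

/-- `1_{U∪V} 1_{U∪V} = 1_{U∪V}`. [this work] -/
theorem w_mul_w : setInd (U ∪ V) * setInd (U ∪ V) = setInd (U ∪ V) := setInd_mul_self' _

/-- `1_{U∪V} (1_U 1_V) = 1_U 1_V`. [this work] -/
theorem w_mul_uv : setInd (U ∪ V) * (setInd U * setInd V) = setInd U * setInd V := by
  rw [setInd_mul, setInd_mul]; congr 1; ext x; simp only [mem_inter, mem_union]; tauto

/-- `1_U (1_U 1_V) = 1_U 1_V`. [this work] -/
theorem u_mul_uv : setInd U * (setInd U * setInd V) = setInd U * setInd V := by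
  rw [← mul_assoc, setInd_mul_self']

/-- `1_V (1_U 1_V) = 1_U 1_V`. [this work] -/
theorem v_mul_uv : setInd V * (setInd U * setInd V) = setInd U * setInd V := by
  rw [mul_left_comm, setInd_mul_self']

/-- `1_U 1_{U∪V} = 1_U`. [this work] -/
theorem u_mul_w : setInd U * setInd (U ∪ V) = setInd U := by
  rw [setInd_mul]; congr 1; ext x; simp only [mem_inter, mem_union]; tauto

/-- `1_V 1_{U∪V} = 1_V`. [this work] -/
theorem v_mul_w : setInd V * setInd (U ∪ V) = setInd V := by
  rw [setInd_mul]; congr 1; ext x; simp only [mem_inter, mem_union]; tauto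

/-- `(1_U 1_V) 1_U`-type in the other association: `1_U 1_V 1_{U∪V}`. [this work] -/
theorem uv_mul_w : setInd U * setInd V * setInd (U ∪ V) = setInd U * setInd V := by
  rw [mul_comm, w_mul_uv]

end TwoSets

/-! ### §2 The gadget and its sections -/

/-- `x ∨ (U ∩ V)`. [this work] -/
def gadA (U V : Finset (Pt d)) : Pt (d + 1) → ℝ := fun x => if x 0 = true then 1 else (setInd U * setInd V) (Fin.tail x)

/-- `U ∨ (x ∧ V)`. [this work] -/
def gadB (U V : Finset (Pt d)) : Pt (d + 1) → ℝ := fun x => if x 0 = true then setInd (U ∪ V) (Fin.tail x) else setInd U (Fin.tail x)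

/-- `V ∨ (x ∧ U)`. [this work] -/
def gadC (U V : Finset (Pt d)) : Pt (d + 1) → ℝ := fun x => if x 0 = true then setInd (U ∪ V) (Fin.tail x) else setInd V (Fin.tail x)

/-- `x ∧ (U ∪ V)`. [this work] -/
def dgadA (U V : Finset (Pt d)) : Pt (d + 1) → ℝ := fun x => if x 0 = true then setInd (U ∪ V) (Fin.tail x) else 0

/-- `U ∧ (x ∨ V)`. [this work] -/
def dgadB (U V : Finset (Pt d)) : Pt (d + 1) → ℝ := fun x => if x 0 = true then setInd U (Fin.tail x) else (setInd U * setInd V) (Fin.tail x)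

/-- `V ∧ (x ∨ U)`. [this work] -/
def dgadC (U V : Finset (Pt d)) : Pt (d + 1) → ℝ := fun x => if x 0 = true then setInd V (Fin.tail x) else (setInd U * setInd V) (Fin.tail x)

section Sections
variable (U V : Finset (Pt d))
/-- section -/ @[simp] theorem sec_gadA_true : sec (gadA U V) true = 1 := by funext x; simp [sec, gadA, Fin.cons_zero]
/-- section -/ @[simp] theorem sec_gadA_false : sec (gadA U V) false = setInd U * setInd V := by
  funext x; simp [sec, gadA, Fin.cons_zero, Fin.tail_cons]
/-- section -/ @[simp] theorem sec_gadB_true : sec (gadB U V) true = setInd (U ∪ V) := by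
  funext x; simp [sec, gadB, Fin.cons_zero, Fin.tail_cons]
/-- section -/ @[simp] theorem sec_gadB_false : sec (gadB U V) false = setInd U := by
  funext x; simp [sec, gadB, Fin.cons_zero, Fin.tail_cons]
/-- section -/ @[simp] theorem sec_gadC_true : sec (gadC U V) true = setInd (U ∪ V) := by
  funext x; simp [sec, gadC, Fin.cons_zero, Fin.tail_cons]
/-- section -/ @[simp] theorem sec_gadC_false : sec (gadC U V) false = setInd V := by
  funext x; simp [sec, gadC, Fin.cons_zero, Fin.tail_cons]
/-- section -/ @[simp] theorem sec_dgadA_true : sec (dgadA U V) true = setInd (U ∪ V) := by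
  funext x; simp [sec, dgadA, Fin.cons_zero, Fin.tail_cons]
/-- section -/ @[simp] theorem sec_dgadA_false : sec (dgadA U V) false = 0 := by funext x; simp [sec, dgadA, Fin.cons_zero]
/-- section -/ @[simp] theorem sec_dgadB_true : sec (dgadB U V) true = setInd U := by
  funext x; simp [sec, dgadB, Fin.cons_zero, Fin.tail_cons]
/-- section -/ @[simp] theorem sec_dgadB_false : sec (dgadB U V) false = setInd U * setInd V := by
  funext x; simp [sec, dgadB, Fin.cons_zero, Fin.tail_cons]
/-- section -/ @[simp] theorem sec_dgadC_true : sec (dgadC U V) true = setInd V := by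
  funext x; simp [sec, dgadC, Fin.cons_zero, Fin.tail_cons]
/-- section -/ @[simp] theorem sec_dgadC_false : sec (dgadC U V) false = setInd U * setInd V := by
  funext x; simp [sec, dgadC, Fin.cons_zero, Fin.tail_cons]
end Sections

section MoreAlgebra
variable (U V : Finset (Pt d))
/-- `1_{U∪V} 1_U = 1_U`. [this work] -/
theorem w_mul_u : setInd (U ∪ V) * setInd U = setInd U := by rw [mul_comm, u_mul_w]
/-- `1_{U∪V} 1_V = 1_V`. [this work] -/
theorem w_mul_v : setInd (U ∪ V) * setInd V = setInd V := by rw [mul_comm, v_mul_w]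
/-- `(1_U 1_V)(1_U 1_V) = 1_U 1_V`. [this work] -/
theorem uv_mul_uv : setInd U * setInd V * (setInd U * setInd V) = setInd U * setInd V := by rw [← mul_assoc, uv_mul_u, uv_mul_v]
end MoreAlgebra

/-- `N_b` vanishes with a zero middle copy. [this work] -/
theorem N3_zero_mid' (b : Fin d → ℕ) (f h : Pt d → ℝ) : N3 b f 0 h = 0 := by rw [N3_comm12, N3_zero_left]

/-- `N_b` vanishes with a zero third copy. [this work] -/
theorem N3_zero_right' (b : Fin d → ℕ) (f g : Pt d → ℝ) : N3 b f g 0 = 0 := by rw [N3_comm13, N3_zero_left]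

/-! ### §3 The facts and the two theorems -/

/-- ★★ **3C-SAHI for the median gadget**: for up-sets `U, V ⊆ {0,1}^d` and every `k`, `b`:
`0 ≤ c_{(k,b)}(x ∨ UV, U ∨ xV, V ∨ xU)`. [this work] -/
theorem tc_gadget_cons_nonneg (k : ℕ) (b : Fin d → ℕ) {U V : Finset (Pt d)} (hU : IsUpperSet (U : Set (Pt d)))
    (hV : IsUpperSet (V : Set (Pt d))) : 0 ≤ tc (Fin.cons k b : Fin (d + 1) → ℕ) (gadA U V) (gadB U V) (gadC U V) := by
  have one0 : ∀ x : Pt d, (0 : ℝ) ≤ (1 : Pt d → ℝ) x := fun _ => zero_le_one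
  have u0 : ∀ x, 0 ≤ setInd U x := setInd_nonneg U
  have v0 : ∀ x, 0 ≤ setInd V x := setInd_nonneg V
  have u1 : ∀ x, setInd U x ≤ 1 := fun x => by unfold setInd; split_ifs <;> norm_num
  have v1 : ∀ x, setInd V x ≤ 1 := fun x => by unfold setInd; split_ifs <;> norm_num
  have nu0 : ∀ x, 0 ≤ (1 - setInd U) x := fun x => sub_nonneg.2 (u1 x)
  have nv0 : ∀ x, 0 ≤ (1 - setInd V) x := fun x => sub_nonneg.2 (v1 x)
  have p0 : ∀ x, 0 ≤ (setInd U * setInd V) x := fun x => mul_nonneg (u0 x) (v0 x)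
  have unv0 : ∀ x, 0 ≤ (setInd U * (1 - setInd V)) x := fun x => mul_nonneg (u0 x) (nv0 x)
  have nuv0 : ∀ x, 0 ≤ ((1 - setInd U) * setInd V) x := fun x => mul_nonneg (nu0 x) (v0 x)
  have nunv0 : ∀ x, 0 ≤ ((1 - setInd U) * (1 - setInd V)) x := fun x => mul_nonneg (nu0 x) (nv0 x)
  have F0 := N3_nonneg b (f := (1 : Pt d → ℝ)) (g := (setInd U * setInd V)) (h := (setInd U * (1 - setInd V))) one0 p0 unv0
  have F1 := N3_nonneg b (f := (1 : Pt d → ℝ)) (g := (setInd U * setInd V)) (h := (1 - setInd U)) one0 p0 nu0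
  have F2 := N3_nonneg b (f := (1 - setInd V)) (g := (setInd U * setInd V)) (h := (1 - setInd U)) nv0 p0 nu0
  have F3 := N3_nonneg b (f := (1 : Pt d → ℝ)) (g := (1 - setInd V)) (h := (setInd U * (1 - setInd V))) one0 nv0 unv0
  have F4 := N3_nonneg b (f := (1 : Pt d → ℝ)) (g := setInd U) (h := (1 - setInd U)) one0 u0 nu0
  have F5 := N3_nonneg b (f := (1 : Pt d → ℝ)) (g := setInd U) (h := ((1 - setInd U) * setInd V)) one0 u0 nuv0
  have F6 := N3_nonneg b (f := (1 : Pt d → ℝ)) (g := (setInd U * setInd V)) (h := ((1 - setInd U) * (1 - setInd V))) one0 p0 nunv0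
  have F7 := N3_nonneg b (f := setInd V) (g := (1 - setInd V)) (h := (setInd U * (1 - setInd V))) v0 nv0 unv0
  have F8 := N3_nonneg b (f := setInd V) (g := (1 - setInd V)) (h := (1 - setInd U)) v0 nv0 nu0
  have F9 := N3_nonneg b (f := setInd V) (g := (setInd U * setInd V)) (h := (setInd U * (1 - setInd V))) v0 p0 unv0
  have F10 := N3_nonneg b (f := setInd V) (g := (setInd U * (1 - setInd V))) (h := (1 - setInd U)) v0 unv0 nu0
  have F11 := N3_nonneg b (f := setInd V) (g := (1 - setInd U)) (h := (1 - setInd U)) v0 nu0 nu0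
  have F12 := N3_nonneg b (f := setInd U) (g := (setInd U * setInd V)) (h := (setInd U * (1 - setInd V))) u0 p0 unv0
  have F13 := N3_nonneg b (f := (1 : Pt d → ℝ)) (g := (1 - setInd V)) (h := ((1 - setInd U) * setInd V)) one0 nv0 nuv0
  have F14 := N3_nonneg b (f := (1 : Pt d → ℝ)) (g := setInd U) (h := ((1 - setInd U) * (1 - setInd V))) one0 u0 nunv0
  have F15 := N3_nonneg b (f := setInd V) (g := (setInd U * (1 - setInd V))) (h := ((1 - setInd U) * (1 - setInd V))) v0 unv0 nunv0
  have F16 := N3_nonneg b (f := (setInd U * setInd V)) (g := (setInd U * setInd V)) (h := ((1 - setInd U) * (1 - setInd V))) p0 p0 nunv0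
  have F17 := N3_nonneg b (f := (1 : Pt d → ℝ)) (g := setInd V) (h := ((1 - setInd U) * (1 - setInd V))) one0 v0 nunv0
  have F18 := N3_nonneg b (f := (1 : Pt d → ℝ)) (g := (setInd U * (1 - setInd V))) (h := ((1 - setInd U) * (1 - setInd V))) one0 unv0 nunv0
  have F19 := N3_nonneg b (f := (setInd U * setInd V)) (g := (setInd U * (1 - setInd V))) (h := ((1 - setInd U) * (1 - setInd V))) p0 unv0 nunv0
  have F20 := N3_nonneg b (f := (setInd U * setInd V)) (g := (1 - setInd U)) (h := ((1 - setInd U) * (1 - setInd V))) p0 nu0 nunv0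
  have F21 := N3_nonneg b (f := (1 - setInd V)) (g := (setInd U * setInd V)) (h := ((1 - setInd U) * (1 - setInd V))) nv0 p0 nunv0
  have G0 := harris3_nonneg b (r := (1 : Pt d → ℝ)) u0 (monotone_setInd hU) v0 (monotone_setInd hV) one0
  have G1 := harris3_nonneg b (r := (1 - setInd V)) u0 (monotone_setInd hU) v0 (monotone_setInd hV) nv0
  have G2 := harris3_nonneg b (r := (setInd U * setInd V)) u0 (monotone_setInd hU) v0 (monotone_setInd hV) p0
  have G3 := harris3_nonneg b (r := (1 - setInd U)) u0 (monotone_setInd hU) v0 (monotone_setInd hV) nu0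
  have e1 : setInd U * (1 - setInd V) = setInd U - setInd U * setInd V := by ring
  have e2 : (1 - setInd U) * setInd V = setInd V - setInd U * setInd V := by ring
  have e3 : (1 - setInd U) * (1 - setInd V) = 1 - setInd U - setInd V + setInd U * setInd V := by ring
  simp only [e1, e2, e3, N3_sub_left, N3_sub_mid, N3_add_right, N3_sub_right,
      N3_comm12 b (1 : Pt d → ℝ) (setInd U) (1 : Pt d → ℝ), N3_comm12 b (1 : Pt d → ℝ) (setInd U) (setInd U), N3_comm12 b (1 : Pt d → ℝ) (setInd U) (setInd V),
      N3_comm12 b (1 : Pt d → ℝ) (setInd U) (setInd U * setInd V), N3_comm12 b (1 : Pt d → ℝ) (setInd V) (1 : Pt d → ℝ), N3_comm12 b (1 : Pt d → ℝ) (setInd V) (setInd U),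
      N3_comm12 b (1 : Pt d → ℝ) (setInd V) (setInd V), N3_comm12 b (1 : Pt d → ℝ) (setInd V) (setInd U * setInd V), N3_comm12 b (1 : Pt d → ℝ) (setInd U * setInd V) (1 : Pt d → ℝ),
      N3_comm12 b (1 : Pt d → ℝ) (setInd U * setInd V) (setInd U), N3_comm12 b (1 : Pt d → ℝ) (setInd U * setInd V) (setInd V), N3_comm12 b (1 : Pt d → ℝ) (setInd U * setInd V) (setInd U * setInd V),
      N3_comm12 b (setInd U) (setInd V) (1 : Pt d → ℝ), N3_comm12 b (setInd U) (setInd V) (setInd U), N3_comm12 b (setInd U) (setInd V) (setInd V),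
      N3_comm12 b (setInd U) (setInd V) (setInd U * setInd V), N3_comm12 b (setInd U) (setInd U * setInd V) (1 : Pt d → ℝ), N3_comm12 b (setInd U) (setInd U * setInd V) (setInd U),
      
      N3_comm12 b (setInd U) (setInd U * setInd V) (setInd U * setInd V), N3_comm12 b (setInd V) (setInd U * setInd V) (1 : Pt d → ℝ), N3_comm12 b (setInd V) (setInd U * setInd V) (setInd U),
      N3_comm12 b (setInd V) (setInd U * setInd V) (setInd V), N3_comm12 b (setInd V) (setInd U * setInd V) (setInd U * setInd V), N3_comm23 b (1 : Pt d → ℝ) (1 : Pt d → ℝ) (setInd U),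
      N3_comm23 b (1 : Pt d → ℝ) (1 : Pt d → ℝ) (setInd V), N3_comm23 b (1 : Pt d → ℝ) (1 : Pt d → ℝ) (setInd U * setInd V),
      
      
      
      N3_comm23 b (setInd U) (1 : Pt d → ℝ) (setInd U), N3_comm23 b (setInd U) (1 : Pt d → ℝ) (setInd V), N3_comm23 b (setInd U) (1 : Pt d → ℝ) (setInd U * setInd V),
      
      
      
      N3_comm23 b (setInd V) (1 : Pt d → ℝ) (setInd U), N3_comm23 b (setInd V) (1 : Pt d → ℝ) (setInd V), N3_comm23 b (setInd V) (1 : Pt d → ℝ) (setInd U * setInd V),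
      N3_comm23 b (setInd V) (setInd U) (setInd V), N3_comm23 b (setInd V) (setInd U) (setInd U * setInd V), N3_comm23 b (setInd V) (setInd V) (setInd U * setInd V),
      N3_comm23 b (setInd U * setInd V) (1 : Pt d → ℝ) (setInd U), N3_comm23 b (setInd U * setInd V) (1 : Pt d → ℝ) (setInd V), N3_comm23 b (setInd U * setInd V) (1 : Pt d → ℝ) (setInd U * setInd V),
      N3_comm23 b (setInd U * setInd V) (setInd U) (setInd V), N3_comm23 b (setInd U * setInd V) (setInd U) (setInd U * setInd V),
      N3_comm23 b (setInd U * setInd V) (setInd V) (setInd U * setInd V)] at F0 F1 F2 F3 F4 F5 F6 F7 F8 F9 F10 F11 F12 F13 F14 F15 F16 F17 F18 F19 F20 F21 G0 G1 G2 G3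
  rcases Nat.lt_or_ge k 4 with hk | hk
  · unfold tc
    rw [N3_cons, N3_cons, N3_cons, N3_cons, N3_cons]
    simp only [Fintype.sum_bool, Bool.toNat_true, Bool.toNat_false, sec_mul, sec_one, sec_gadA_true, sec_gadA_false, sec_gadB_true,
      sec_gadB_false, sec_gadC_true, sec_gadC_false, one_mul, uv_mul_u, uv_mul_v, w_mul_w]
    rw [setInd_union_eq]
    simp only [N3_add_left, N3_sub_left, N3_add_mid, N3_sub_mid, N3_add_right, N3_sub_right]
    simp only [N3_comm12 b (1 : Pt d → ℝ) (setInd U) (1 : Pt d → ℝ),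
      N3_comm12 b (1 : Pt d → ℝ) (setInd U) (setInd U), N3_comm12 b (1 : Pt d → ℝ) (setInd U) (setInd V), N3_comm12 b (1 : Pt d → ℝ) (setInd U) (setInd U * setInd V),
      N3_comm12 b (1 : Pt d → ℝ) (setInd V) (1 : Pt d → ℝ), N3_comm12 b (1 : Pt d → ℝ) (setInd V) (setInd U), N3_comm12 b (1 : Pt d → ℝ) (setInd V) (setInd V),
      N3_comm12 b (1 : Pt d → ℝ) (setInd V) (setInd U * setInd V), N3_comm12 b (1 : Pt d → ℝ) (setInd U * setInd V) (1 : Pt d → ℝ), N3_comm12 b (1 : Pt d → ℝ) (setInd U * setInd V) (setInd U),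
      N3_comm12 b (1 : Pt d → ℝ) (setInd U * setInd V) (setInd V), N3_comm12 b (1 : Pt d → ℝ) (setInd U * setInd V) (setInd U * setInd V), N3_comm12 b (setInd U) (setInd V) (1 : Pt d → ℝ),
      
      
      
      N3_comm12 b (setInd U) (setInd U * setInd V) (1 : Pt d → ℝ),
      
      
      
      N3_comm12 b (setInd V) (setInd U * setInd V) (1 : Pt d → ℝ),
      
      
      
      
      
      
      
      
      
      N3_comm23 b (setInd U) (1 : Pt d → ℝ) (setInd U), N3_comm23 b (setInd U) (1 : Pt d → ℝ) (setInd V), N3_comm23 b (setInd U) (1 : Pt d → ℝ) (setInd U * setInd V),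
      
      
      
      N3_comm23 b (setInd V) (1 : Pt d → ℝ) (setInd U), N3_comm23 b (setInd V) (1 : Pt d → ℝ) (setInd V), N3_comm23 b (setInd V) (1 : Pt d → ℝ) (setInd U * setInd V),
      
      
      
      N3_comm23 b (setInd U * setInd V) (1 : Pt d → ℝ) (setInd U), N3_comm23 b (setInd U * setInd V) (1 : Pt d → ℝ) (setInd V), N3_comm23 b (setInd U * setInd V) (1 : Pt d → ℝ) (setInd U * setInd V),
      N3_comm23 b (setInd U * setInd V) (setInd U) (setInd V), N3_comm23 b (setInd U * setInd V) (setInd U) (setInd U * setInd V),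
      N3_comm23 b (setInd U * setInd V) (setInd V) (setInd U * setInd V)]
    interval_cases k <;> norm_num <;> linarith
  · obtain ⟨j, rfl⟩ : ∃ j, k = j + 4 := ⟨k - 4, by omega⟩
    unfold tc; simp [N3_cons_add_four]

/-- ★ **3C-SAHI for the dual gadget** `(x(U∨V), U(x∨V), V(x∨U))`. [this work] -/
theorem tc_dualGadget_cons_nonneg (k : ℕ) (b : Fin d → ℕ) {U V : Finset (Pt d)} (hU : IsUpperSet (U : Set (Pt d)))
    (hV : IsUpperSet (V : Set (Pt d))) : 0 ≤ tc (Fin.cons k b : Fin (d + 1) → ℕ) (dgadA U V) (dgadB U V) (dgadC U V) := by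
  have one0 : ∀ x : Pt d, (0 : ℝ) ≤ (1 : Pt d → ℝ) x := fun _ => zero_le_one
  have u0 : ∀ x, 0 ≤ setInd U x := setInd_nonneg U
  have v0 : ∀ x, 0 ≤ setInd V x := setInd_nonneg V
  have u1 : ∀ x, setInd U x ≤ 1 := fun x => by unfold setInd; split_ifs <;> norm_num
  have v1 : ∀ x, setInd V x ≤ 1 := fun x => by unfold setInd; split_ifs <;> norm_num
  have nu0 : ∀ x, 0 ≤ (1 - setInd U) x := fun x => sub_nonneg.2 (u1 x)
  have nv0 : ∀ x, 0 ≤ (1 - setInd V) x := fun x => sub_nonneg.2 (v1 x)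
  have p0 : ∀ x, 0 ≤ (setInd U * setInd V) x := fun x => mul_nonneg (u0 x) (v0 x)
  have unv0 : ∀ x, 0 ≤ (setInd U * (1 - setInd V)) x := fun x => mul_nonneg (u0 x) (nv0 x)
  have nuv0 : ∀ x, 0 ≤ ((1 - setInd U) * setInd V) x := fun x => mul_nonneg (nu0 x) (v0 x)
  have nunv0 : ∀ x, 0 ≤ ((1 - setInd U) * (1 - setInd V)) x := fun x => mul_nonneg (nu0 x) (nv0 x)
  have F0 := N3_nonneg b (f := (1 : Pt d → ℝ)) (g := (setInd U * setInd V)) (h := (setInd U * (1 - setInd V))) one0 p0 unv0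
  have F1 := N3_nonneg b (f := (1 : Pt d → ℝ)) (g := (setInd U * setInd V)) (h := (1 - setInd U)) one0 p0 nu0
  have F2 := N3_nonneg b (f := (1 - setInd V)) (g := (setInd U * setInd V)) (h := (1 - setInd U)) nv0 p0 nu0
  have F3 := N3_nonneg b (f := (1 : Pt d → ℝ)) (g := (1 - setInd V)) (h := (setInd U * (1 - setInd V))) one0 nv0 unv0
  have F4 := N3_nonneg b (f := (1 : Pt d → ℝ)) (g := setInd U) (h := (1 - setInd U)) one0 u0 nu0
  have F5 := N3_nonneg b (f := (1 : Pt d → ℝ)) (g := setInd U) (h := ((1 - setInd U) * setInd V)) one0 u0 nuv0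
  have F6 := N3_nonneg b (f := (1 : Pt d → ℝ)) (g := (setInd U * setInd V)) (h := ((1 - setInd U) * (1 - setInd V))) one0 p0 nunv0
  have F7 := N3_nonneg b (f := setInd V) (g := (1 - setInd V)) (h := (setInd U * (1 - setInd V))) v0 nv0 unv0
  have F8 := N3_nonneg b (f := setInd V) (g := (1 - setInd V)) (h := (1 - setInd U)) v0 nv0 nu0
  have F9 := N3_nonneg b (f := setInd V) (g := (setInd U * setInd V)) (h := (setInd U * (1 - setInd V))) v0 p0 unv0
  have F10 := N3_nonneg b (f := setInd V) (g := (setInd U * (1 - setInd V))) (h := (1 - setInd U)) v0 unv0 nu0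
  have F11 := N3_nonneg b (f := setInd V) (g := (1 - setInd U)) (h := (1 - setInd U)) v0 nu0 nu0
  have F12 := N3_nonneg b (f := setInd U) (g := (setInd U * setInd V)) (h := (setInd U * (1 - setInd V))) u0 p0 unv0
  have F13 := N3_nonneg b (f := (1 : Pt d → ℝ)) (g := (1 - setInd V)) (h := ((1 - setInd U) * setInd V)) one0 nv0 nuv0
  have F14 := N3_nonneg b (f := (1 : Pt d → ℝ)) (g := setInd U) (h := ((1 - setInd U) * (1 - setInd V))) one0 u0 nunv0
  have F15 := N3_nonneg b (f := setInd V) (g := (setInd U * (1 - setInd V))) (h := ((1 - setInd U) * (1 - setInd V))) v0 unv0 nunv0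
  have F16 := N3_nonneg b (f := (setInd U * setInd V)) (g := (setInd U * setInd V)) (h := ((1 - setInd U) * (1 - setInd V))) p0 p0 nunv0
  have F17 := N3_nonneg b (f := (1 : Pt d → ℝ)) (g := setInd V) (h := ((1 - setInd U) * (1 - setInd V))) one0 v0 nunv0
  have F18 := N3_nonneg b (f := (1 : Pt d → ℝ)) (g := (setInd U * (1 - setInd V))) (h := ((1 - setInd U) * (1 - setInd V))) one0 unv0 nunv0
  have F19 := N3_nonneg b (f := (setInd U * setInd V)) (g := (setInd U * (1 - setInd V))) (h := ((1 - setInd U) * (1 - setInd V))) p0 unv0 nunv0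
  have F20 := N3_nonneg b (f := (setInd U * setInd V)) (g := (1 - setInd U)) (h := ((1 - setInd U) * (1 - setInd V))) p0 nu0 nunv0
  have F21 := N3_nonneg b (f := (1 - setInd V)) (g := (setInd U * setInd V)) (h := ((1 - setInd U) * (1 - setInd V))) nv0 p0 nunv0
  have G0 := harris3_nonneg b (r := (1 : Pt d → ℝ)) u0 (monotone_setInd hU) v0 (monotone_setInd hV) one0
  have G1 := harris3_nonneg b (r := (1 - setInd V)) u0 (monotone_setInd hU) v0 (monotone_setInd hV) nv0
  have G2 := harris3_nonneg b (r := (setInd U * setInd V)) u0 (monotone_setInd hU) v0 (monotone_setInd hV) p0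
  have G3 := harris3_nonneg b (r := (1 - setInd U)) u0 (monotone_setInd hU) v0 (monotone_setInd hV) nu0
  have e1 : setInd U * (1 - setInd V) = setInd U - setInd U * setInd V := by ring
  have e2 : (1 - setInd U) * setInd V = setInd V - setInd U * setInd V := by ring
  have e3 : (1 - setInd U) * (1 - setInd V) = 1 - setInd U - setInd V + setInd U * setInd V := by ring
  simp only [e1, e2, e3, N3_sub_left, N3_sub_mid, N3_add_right, N3_sub_right,
      N3_comm12 b (1 : Pt d → ℝ) (setInd U) (1 : Pt d → ℝ), N3_comm12 b (1 : Pt d → ℝ) (setInd U) (setInd U), N3_comm12 b (1 : Pt d → ℝ) (setInd U) (setInd V),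
      N3_comm12 b (1 : Pt d → ℝ) (setInd U) (setInd U * setInd V), N3_comm12 b (1 : Pt d → ℝ) (setInd V) (1 : Pt d → ℝ), N3_comm12 b (1 : Pt d → ℝ) (setInd V) (setInd U),
      N3_comm12 b (1 : Pt d → ℝ) (setInd V) (setInd V), N3_comm12 b (1 : Pt d → ℝ) (setInd V) (setInd U * setInd V), N3_comm12 b (1 : Pt d → ℝ) (setInd U * setInd V) (1 : Pt d → ℝ),
      N3_comm12 b (1 : Pt d → ℝ) (setInd U * setInd V) (setInd U), N3_comm12 b (1 : Pt d → ℝ) (setInd U * setInd V) (setInd V), N3_comm12 b (1 : Pt d → ℝ) (setInd U * setInd V) (setInd U * setInd V),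
      N3_comm12 b (setInd U) (setInd V) (1 : Pt d → ℝ), N3_comm12 b (setInd U) (setInd V) (setInd U), N3_comm12 b (setInd U) (setInd V) (setInd V),
      N3_comm12 b (setInd U) (setInd V) (setInd U * setInd V), N3_comm12 b (setInd U) (setInd U * setInd V) (1 : Pt d → ℝ), N3_comm12 b (setInd U) (setInd U * setInd V) (setInd U),
      
      N3_comm12 b (setInd U) (setInd U * setInd V) (setInd U * setInd V), N3_comm12 b (setInd V) (setInd U * setInd V) (1 : Pt d → ℝ), N3_comm12 b (setInd V) (setInd U * setInd V) (setInd U),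
      N3_comm12 b (setInd V) (setInd U * setInd V) (setInd V), N3_comm12 b (setInd V) (setInd U * setInd V) (setInd U * setInd V), N3_comm23 b (1 : Pt d → ℝ) (1 : Pt d → ℝ) (setInd U),
      N3_comm23 b (1 : Pt d → ℝ) (1 : Pt d → ℝ) (setInd V), N3_comm23 b (1 : Pt d → ℝ) (1 : Pt d → ℝ) (setInd U * setInd V),
      
      
      
      N3_comm23 b (setInd U) (1 : Pt d → ℝ) (setInd U), N3_comm23 b (setInd U) (1 : Pt d → ℝ) (setInd V), N3_comm23 b (setInd U) (1 : Pt d → ℝ) (setInd U * setInd V),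
      
      
      
      N3_comm23 b (setInd V) (1 : Pt d → ℝ) (setInd U), N3_comm23 b (setInd V) (1 : Pt d → ℝ) (setInd V), N3_comm23 b (setInd V) (1 : Pt d → ℝ) (setInd U * setInd V),
      N3_comm23 b (setInd V) (setInd U) (setInd V), N3_comm23 b (setInd V) (setInd U) (setInd U * setInd V), N3_comm23 b (setInd V) (setInd V) (setInd U * setInd V),
      N3_comm23 b (setInd U * setInd V) (1 : Pt d → ℝ) (setInd U), N3_comm23 b (setInd U * setInd V) (1 : Pt d → ℝ) (setInd V), N3_comm23 b (setInd U * setInd V) (1 : Pt d → ℝ) (setInd U * setInd V),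
      N3_comm23 b (setInd U * setInd V) (setInd U) (setInd V), N3_comm23 b (setInd U * setInd V) (setInd U) (setInd U * setInd V),
      N3_comm23 b (setInd U * setInd V) (setInd V) (setInd U * setInd V)] at F0 F1 F2 F3 F4 F5 F6 F7 F8 F9 F10 F11 F12 F13 F14 F15 F16 F17 F18 F19 F20 F21 G0 G1 G2 G3
  rcases Nat.lt_or_ge k 4 with hk | hk
  · unfold tc
    rw [N3_cons, N3_cons, N3_cons, N3_cons, N3_cons]
    simp only [Fintype.sum_bool, Bool.toNat_true, Bool.toNat_false, sec_mul, sec_one, sec_dgadA_true, sec_dgadA_false, sec_dgadB_true,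
      sec_dgadB_false, sec_dgadC_true, sec_dgadC_false, zero_mul, N3_zero_left, N3_zero_mid',
      w_mul_u, w_mul_v, uv_mul_uv]
    rw [setInd_union_eq]
    simp only [N3_add_left, N3_sub_left]
    simp only [
      
      
      
      
      
      
      
      
      
      
      
      N3_comm12 b (setInd U) (setInd V) (1 : Pt d → ℝ), N3_comm12 b (setInd U) (setInd V) (setInd U),
      
      
      N3_comm12 b (setInd U) (setInd U * setInd V) (1 : Pt d → ℝ), N3_comm12 b (setInd U) (setInd U * setInd V) (setInd U), N3_comm12 b (setInd U) (setInd U * setInd V) (setInd V),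
      N3_comm12 b (setInd U) (setInd U * setInd V) (setInd U * setInd V), N3_comm12 b (setInd V) (setInd U * setInd V) (1 : Pt d → ℝ), N3_comm12 b (setInd V) (setInd U * setInd V) (setInd U),
      N3_comm12 b (setInd V) (setInd U * setInd V) (setInd V), N3_comm12 b (setInd V) (setInd U * setInd V) (setInd U * setInd V),
      
      
      
      
      
      
      
      
      
      N3_comm23 b (setInd U) (setInd U) (setInd V), N3_comm23 b (setInd U) (setInd U) (setInd U * setInd V),
      
      
      
      
      N3_comm23 b (setInd V) (setInd U) (setInd V), N3_comm23 b (setInd V) (setInd U) (setInd U * setInd V),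
      
      
      
      
      N3_comm23 b (setInd U * setInd V) (setInd U) (setInd V), N3_comm23 b (setInd U * setInd V) (setInd U) (setInd U * setInd V),
      N3_comm23 b (setInd U * setInd V) (setInd V) (setInd U * setInd V)]
    interval_cases k <;> norm_num <;> linarith
  · obtain ⟨j, rfl⟩ : ∃ j, k = j + 4 := ⟨k - 4, by omega⟩
    unfold tc; simp [N3_cons_add_four]

end

end Summit.CriticalPhenomena.PercolationContinuityZ3.Theorems.SahiThreeCopy
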